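/-
Copyright (c) 2026. All rights reserved.
Released under Apache 2.0 license as described in the file LICENSE.
Authors: abc-iut cell, seat abc-iut-L6-t6 (gen 5; junction row «J-Fmod», L6-lead §F v1.19g; part 1 of 2).
-/
import Literature.AlgebraicGeometry.Frobenioids.ModelFrobenioidBaseChangeEquivalence
import Literature.IUT.HodgeTheaters.GlobalFrobenioidsModel
import Literature.IUT.LogThetaLattice.GlobalFrobenioidModelsData
import HarnessLib

/-!
# [IUTchI] Ex 5.1 (iii): `†ℱ^⊛_mod` of a global Frobenioid ≌ the model Frobenioid of a ONE-POINT datum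
# (junction «J-Fmod», part 1: the generic [FrdI] Thm 5.2 (i) bookkeeping)

S. Mochizuki, *Inter-universal Teichmüller Theory I*, §5, Example 5.1 (iii), kurims manuscript (May 2020)
p. 126 ([IUTchI] Ex 5.1 (iii) p.126) [claim: Mochizuki2012, status: disputed]: "`†ℱ^⊛_mod := †ℱ^⊛|_{terminal
objects}` … the restriction of `†ℱ^⊛` to the full subcategory of `†𝒟^⊛` determined by the terminal objects
[i.e., "`C_{F_mod}`"] … the Frobenioid of arithmetic line bundles on the stack `S_mod`"; *Inter-universal
Teichmüller Theory III*, Example 3.6 (ii) p. 108 ([IUTchIII] Ex 3.6 (ii) p.108): "a natural Frobenioid structure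
[cf. [FrdI], Definition 1.3], for which the base category is the category with precisely one arrow";
[cite: MochizukiFrdI2008, Thm. 5.2(i) p.100] and [cite: MochizukiFrdI2008, Cor. 5.4 p.104] for the mathematics.

abc-iut-L5-t1 typed `†ℱ^⊛_mod` LITERALLY (`GlobalFrobenioid.Fmod`, `GlobalFrobenioidsModel.lean`): the full
subcategory of `†ℱ^⊛` — any category equivalent to the model Frobenioid `ℱ^⊛(†𝒟^⊚)` of divisor data `Δ` over
`†𝒟^⊛ = ℬ(G)⁰` — on the objects whose (identified) base is terminal.  Layer L6 realises `(†𝓕⊛_mod)_α` as a model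
Frobenioid over the ONE-ARROW base (abc-iut-L6-t6's `GlobalFrobenioidModels.FrakModel`, `Prop37.FmodModel`).
This PART 1 is the generic comparison of the two shapes (CONSTRUCTIONS + THEOREMS; no `Prop`-valued named fact):

* §1 (any base `D₂`, object `T`): the functor `∗ ↦ T` (`FmodJunction.pointFunctor`) is faithful, and full when
  `T` is terminal; for a morphism of model data OVER it (abc-iut-w5-d048's `ModelFrobenioid.DataHomOver`) with
  bijective components the induced functor of model Frobenioids is fully faithful (abc-iut-w5-d137's
  `functor_full` / `functor_faithful`) and every object whose base is terminal lies in its essential image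
  (`exists_iso_functor_obj`, via w5-d137's `nonempty_iso_of_baseIso`).
* §2 (any `GF : GlobalFrobenioid Δ Dcirc toBase0`): `overTerminal A ↔` "the base of `equiv A` is terminal"
  (`overTerminal_iff`, along L5-t1's `toBase_compat`); the lift `FmodJunction.lift` of `Ψ ⋙ equiv⁻¹` to
  `†ℱ^⊛_mod` is an EQUIVALENCE (`lift_isEquivalence`), whence
  **`FmodJunction.fmodEquiv : GF.Fmod ≌ ModelFrobenioid Φ₁ B₁ DivB₁`** for every one-point datum
  `(Φ₁, B₁, DivB₁)` mapping bijectively to `Δ` at a terminal object `T` ("`C_{F_mod}`").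

Part 2 (`GlobalFrobenioidsFmodJunction.lean`) supplies the datum at the ARITHMETIC MODEL `GlobalDivisorData.arith F`
and the junction `GF.Fmod ≌ Prop37.FmodModel F`.  Nothing here asserts a disputed claim or takes a side on
[IUTchIII] Cor. 3.12 (typed ≠ discharged; instantiated ≠ endorsed).
-/

noncomputable section

namespace Literature.IUT.LogThetaLattice

open CategoryTheory Opposite Function CategoryTheory.Limits
open Literature.AlgebraicGeometry.Frobenioids Literature.IUT.HodgeTheaters
/-! ## §1 Model Frobenioids: a morphism of model data over `∗ ↦ T`, `T` terminal -/

namespace FmodJunction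

universe w v₂ u₂ u

section Point

variable {D₂ : Type u₂} [Category.{v₂} D₂]

/-- The functor `∗ ↦ T` from "the category with precisely one arrow" ([IUTchIII] Ex 3.6 (ii) p. 108;
abc-iut-L6-t6's `GlobalFrobenioidModels.Base`) to a base category `D₂`, at an object `T`.
[cite: MochizukiFrdI2008, Thm. 5.2(i) p.100] -/
abbrev pointFunctor (T : D₂) : GlobalFrobenioidModels.Base.{w} ⥤ D₂ :=
  (Functor.const GlobalFrobenioidModels.Base.{w}).obj T

/-- `∗ ↦ T` is faithful (the one-arrow category has subsingleton hom-sets).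
[cite: MochizukiFrdI2008, Thm. 5.2(i) p.100] -/
theorem pointFunctor_faithful (T : D₂) : (pointFunctor.{w} T).Faithful :=
  ⟨fun {_ _} _ _ _ => Subsingleton.elim _ _⟩

/-- `∗ ↦ T` is full when `T` is terminal (`End(T) = {id}`). [cite: MochizukiFrdI2008, Thm. 5.2(i) p.100] -/
theorem pointFunctor_full {T : D₂} (hT : IsTerminal T) : (pointFunctor.{w} T).Full :=
  ⟨fun {X Y} _ => ⟨eqToHom (Subsingleton.elim X Y), hT.hom_ext _ _⟩⟩

variable {Φ₂ B₂ : D₂ᵒᵖ ⥤ CommMonCat.{w}} {DivB₂ : B₂ ⟶ monoidGp Φ₂}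
  {Φ₁ B₁ : (GlobalFrobenioidModels.Base.{w})ᵒᵖ ⥤ CommMonCat.{w}} {DivB₁ : B₁ ⟶ monoidGp Φ₁}
  {T : D₂} (h : ModelFrobenioid.DataHomOver (pointFunctor.{w} T) DivB₁ DivB₂)

/-- The induced functor of model Frobenioids lands over `T`: `Base(Ψ X) = T`.
[cite: MochizukiFrdI2008, Thm. 5.2(i) p.100] -/
theorem functor_obj_base (X : ModelFrobenioid Φ₁ B₁ DivB₁) : (h.functor.obj X).base = T := rfl

/-- The induced functor is faithful when `η`, `β` are injective at the unique object (abc-iut-w5-d137's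
`functor_faithful`). [cite: MochizukiFrdI2008, Cor. 5.4 p.104] -/
theorem functor_faithful (hη : Injective (h.η.app (op GlobalFrobenioidModels.pt)).hom)
    (hβ : Injective (h.β.app (op GlobalFrobenioidModels.pt)).hom) : h.functor.Faithful := by
  haveI := pointFunctor_faithful.{w} T
  exact h.functor_faithful (fun X => by obtain ⟨⟨⟩⟩ := X; exact hη) (fun X => by obtain ⟨⟨⟩⟩ := X; exact hβ)

/-- The induced functor is full when `T` is terminal, `η` is bijective and `β` surjective at the unique object
(abc-iut-w5-d137's `functor_full`). [cite: MochizukiFrdI2008, Cor. 5.4 p.104] -/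
theorem functor_full (hT : IsTerminal T) (hη : Bijective (h.η.app (op GlobalFrobenioidModels.pt)).hom)
    (hβ : Surjective (h.β.app (op GlobalFrobenioidModels.pt)).hom) : h.functor.Full := by
  haveI := pointFunctor_full.{w} hT
  exact h.functor_full (fun X => by obtain ⟨⟨⟩⟩ := X; exact hη) (fun X => by obtain ⟨⟨⟩⟩ := X; exact hβ)

/-- Every object of the target model Frobenioid whose base is TERMINAL is isomorphic to an object in the image:
its base is (uniquely) isomorphic to `T`, `(T, Φ(i)^gp α') ≅ (A', α')` by `(1, i, 0, 0)` (w5-d137's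
`nonempty_iso_of_baseIso`), and `η^gp` is onto. [cite: MochizukiFrdI2008, Thm. 5.2(i) p.100] -/
theorem exists_iso_functor_obj (hT : IsTerminal T)
    (hη : Bijective (h.η.app (op GlobalFrobenioidModels.pt)).hom)
    (Y : ModelFrobenioid Φ₂ B₂ DivB₂) (hY : IsTerminal Y.base) :
    ∃ X : ModelFrobenioid Φ₁ B₁ DivB₁, Nonempty (h.functor.obj X ≅ Y) := by
  let i : T ≅ Y.base := hT.uniqueUpToIso hY
  obtain ⟨α, hα⟩ := (gpMap_bijective_of_bijective _ hη).2 (pullGp Φ₂ i.hom Y.cls)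
  refine ⟨⟨GlobalFrobenioidModels.pt, α⟩, ?_⟩
  rw [h.functor_obj]
  change Nonempty ((⟨T, gpApp h.η (op GlobalFrobenioidModels.pt) α⟩ : ModelFrobenioid Φ₂ B₂ DivB₂) ≅
    ⟨Y.base, Y.cls⟩)
  rw [show gpApp h.η (op GlobalFrobenioidModels.pt) α = pullGp Φ₂ i.hom Y.cls from hα]
  exact ModelFrobenioid.DataHomOver.nonempty_iso_of_baseIso i Y.cls

end Point

/-! ## §2 `†ℱ^⊛_mod` of a global Frobenioid versus the model Frobenioid of a one-point datum -/

section Fmod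

variable {G : ProfiniteGrp.{u}} {Δ : GlobalDivisorData G} {Dcirc : Type (u + 1)} [Category.{u} Dcirc]
  {toBase0 : Dcirc ⥤ BaseCat G} (GF : GlobalFrobenioid Δ Dcirc toBase0)

/-- An object `A` of `†ℱ^⊛` lies over a terminal object of `†𝒟^⊛` (abc-iut-L5-t1's `overTerminal`: the
identified base `identify (toBase A)` is terminal) iff the base of its image `equiv A` in the model Frobenioid
`ℱ^⊛(†𝒟^⊚)` is terminal — along L5-t1's `toBase_compat : toBase ⋙ identify ≅ equiv ⋙ (ℱ^⊛(†𝒟^⊚) → †𝒟^⊛)`.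
([IUTchI] Ex 5.1 (iii) p.126) [claim: Mochizuki2012, status: disputed] -/
theorem overTerminal_iff (A : GF.cat) :
    GF.overTerminal A ↔ Nonempty (IsTerminal (GF.equiv.functor.obj A).base) :=
  ⟨fun ⟨hA⟩ => ⟨hA.ofIso (GF.toBase_compat.app A)⟩, fun ⟨hA⟩ => ⟨hA.ofIso (GF.toBase_compat.app A).symm⟩⟩

variable {Φ₁ B₁ : (GlobalFrobenioidModels.Base.{u})ᵒᵖ ⥤ CommMonCat.{u}} {DivB₁ : B₁ ⟶ monoidGp Φ₁}
  {T : BaseCat G} (h : ModelFrobenioid.DataHomOver (pointFunctor.{u} T) DivB₁ Δ.div)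

/-- For `T` terminal, `equiv⁻¹ (Ψ X)` lies over a terminal object, `Ψ` the functor induced by a morphism of
model data over `∗ ↦ T`. ([IUTchI] Ex 5.1 (iii) p.126) [claim: Mochizuki2012, status: disputed] -/
theorem overTerminal_inverse_functor_obj (hT : IsTerminal T) (X : ModelFrobenioid Φ₁ B₁ DivB₁) :
    GF.overTerminal (GF.equiv.inverse.obj (h.functor.obj X)) :=
  (overTerminal_iff GF _).mpr
    ⟨hT.ofIso (Δ.modelBase.mapIso (GF.equiv.counitIso.app (h.functor.obj X))).symm⟩

/-- **The comparison functor `ModelFrobenioid(∗; Φ₁, B₁, Div) ⥤ †ℱ^⊛_mod`**: `Ψ` followed by `equiv⁻¹`, lifted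
to the full subcategory `†ℱ^⊛_mod` (`T` terminal). ([IUTchI] Ex 5.1 (iii) p.126) [claim: Mochizuki2012, status: disputed] -/
def lift (hT : IsTerminal T) : ModelFrobenioid Φ₁ B₁ DivB₁ ⥤ GF.Fmod :=
  GF.overTerminal.lift (h.functor ⋙ GF.equiv.inverse) (overTerminal_inverse_functor_obj GF h hT)

/-- `lift` on objects (underlying object of `†ℱ^⊛`). ([IUTchI] Ex 5.1 (iii) p.126) [claim: Mochizuki2012, status: disputed] -/
theorem lift_obj_obj (hT : IsTerminal T) (X : ModelFrobenioid Φ₁ B₁ DivB₁) :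
    ((lift GF h hT).obj X).obj = GF.equiv.inverse.obj (h.functor.obj X) := rfl

/-- `lift` on morphisms (underlying morphism of `†ℱ^⊛`). ([IUTchI] Ex 5.1 (iii) p.126) [claim: Mochizuki2012, status: disputed] -/
theorem lift_map_hom (hT : IsTerminal T) {X Y : ModelFrobenioid Φ₁ B₁ DivB₁} (φ : X ⟶ Y) :
    ((lift GF h hT).map φ).hom = GF.equiv.inverse.map (h.functor.map φ) := rfl

/-- `lift ⋙ (†ℱ^⊛_mod ↪ †ℱ^⊛) = Ψ ⋙ equiv⁻¹`, on the nose. ([IUTchI] Ex 5.1 (iii) p.126) [claim: Mochizuki2012, status: disputed] -/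
theorem lift_comp_fmodIncl (hT : IsTerminal T) : lift GF h hT ⋙ GF.fmodIncl = h.functor ⋙ GF.equiv.inverse :=
  rfl

/-- `lift` is faithful (`η`, `β` injective). ([IUTchI] Ex 5.1 (iii) p.126) [claim: Mochizuki2012, status: disputed] -/
theorem lift_faithful (hT : IsTerminal T) (hη : Injective (h.η.app (op GlobalFrobenioidModels.pt)).hom)
    (hβ : Injective (h.β.app (op GlobalFrobenioidModels.pt)).hom) : (lift GF h hT).Faithful := by
  haveI := functor_faithful h hη hβ
  exact inferInstanceAs (GF.overTerminal.lift (h.functor ⋙ GF.equiv.inverse) _).Faithful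

/-- `lift` is full (`η` bijective, `β` surjective). ([IUTchI] Ex 5.1 (iii) p.126) [claim: Mochizuki2012, status: disputed] -/
theorem lift_full (hT : IsTerminal T) (hη : Bijective (h.η.app (op GlobalFrobenioidModels.pt)).hom)
    (hβ : Surjective (h.β.app (op GlobalFrobenioidModels.pt)).hom) : (lift GF h hT).Full := by
  haveI := functor_full h hT hη hβ
  exact inferInstanceAs (GF.overTerminal.lift (h.functor ⋙ GF.equiv.inverse) _).Full

/-- `lift` is essentially surjective (`η` bijective): an object of `†ℱ^⊛_mod` has terminal model base, so it is
isomorphic to `equiv⁻¹ (Ψ X)` for some `X`. ([IUTchI] Ex 5.1 (iii) p.126) [claim: Mochizuki2012, status: disputed] -/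
theorem lift_essSurj (hT : IsTerminal T) (hη : Bijective (h.η.app (op GlobalFrobenioidModels.pt)).hom) :
    (lift GF h hT).EssSurj := by
  refine ⟨fun A => ?_⟩
  obtain ⟨hA⟩ := (overTerminal_iff GF A.obj).mp A.property
  obtain ⟨X, ⟨e⟩⟩ := exists_iso_functor_obj h hT hη (GF.equiv.functor.obj A.obj) hA
  exact ⟨X, ⟨GF.overTerminal.isoMk
    ((GF.equiv.inverse.mapIso e).trans (GF.equiv.unitIso.app A.obj).symm)⟩⟩

/-- **`lift` is an equivalence of categories** (`η`, `β` bijective at the unique object, `T` terminal).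
([IUTchI] Ex 5.1 (iii) p.126) [claim: Mochizuki2012, status: disputed] -/
theorem lift_isEquivalence (hT : IsTerminal T) (hη : Bijective (h.η.app (op GlobalFrobenioidModels.pt)).hom)
    (hβ : Bijective (h.β.app (op GlobalFrobenioidModels.pt)).hom) : (lift GF h hT).IsEquivalence := by
  haveI := lift_faithful GF h hT hη.1 hβ.1
  haveI := lift_full GF h hT hη hβ.2
  haveI := lift_essSurj GF h hT hη
  exact {}

/-- **`†ℱ^⊛_mod ≌ ModelFrobenioid(∗; Φ₁, B₁, Div)`** for every one-point datum mapping bijectively to `Δ` at a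
terminal object `T` of `†𝒟^⊛`. ([IUTchI] Ex 5.1 (iii) p.126) [claim: Mochizuki2012, status: disputed] -/
def fmodEquiv (hT : IsTerminal T) (hη : Bijective (h.η.app (op GlobalFrobenioidModels.pt)).hom)
    (hβ : Bijective (h.β.app (op GlobalFrobenioidModels.pt)).hom) : GF.Fmod ≌ ModelFrobenioid Φ₁ B₁ DivB₁ :=
  haveI := lift_isEquivalence GF h hT hη hβ
  (lift GF h hT).asEquivalence.symm

/-- The inverse of `fmodEquiv` IS `lift`. ([IUTchI] Ex 5.1 (iii) p.126) [claim: Mochizuki2012, status: disputed] -/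
theorem fmodEquiv_inverse (hT : IsTerminal T) (hη : Bijective (h.η.app (op GlobalFrobenioidModels.pt)).hom)
    (hβ : Bijective (h.β.app (op GlobalFrobenioidModels.pt)).hom) :
    (fmodEquiv GF h hT hη hβ).inverse = lift GF h hT := rfl

end Fmod

end FmodJunction

end Literature.IUT.LogThetaLattice

end
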